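import Literature.Analysis.FluidPDE.SawtoothCascade
import Mathlib.Analysis.Complex.ExponentialBounds

/-!
# K2 lane (route-2 `SawtoothPulseCascade`, crux dir `K1LocalisedCascade`): the STABLE kink-sheet block is DETUNED from the kink forcing by at least `399/401`

Helper file of the K2 lane (ACL item stmt-AnomalousDissipation-19491; S2-cert forced part / P1″, A26-4 (a)). For a streamwise wavenumber `k ≥ 1` the
Kelvin–Helmholtz sheet block of the family `(k, β)` is stable and rotates at `ω(k,β) = k·√(max 0 c²(k,β))` (`c² = sawC2`, the tree's `(π/2 + 2Σ₀)² − 4|S|²`),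
while the single-mode forcing carries the kink phases `e^{∓iπks/…}` of frequency `πk/2` (`…KHForcingClosedForm`). p4's «detuning exactly 1»
(`K2ConeInvariant.md` §5: `ω ≈ πk/2 − 1`) made rigorous as a ONE-SIDED bound, uniformly in the Bloch phase:
* `sawSigma0_le_of_pos` / `le_sawSigma0_of_pos`: `−(1+q)/(2k(1−q)) ≤ Σ₀(k,β) ≤ −(1−q)/(2k(1+q))`, `q = e^{−2πk}` (`1 − 2q cos + q² ∈ [(1−q)², (1+q)²]`);
* `sawC2_le_sq`: `c² ≤ (π/2 + 2Σ₀)²`;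
* `sawQ_le_of_one_le`: `q ≤ 1/400` for `k ≥ 1` (`e^{2π} ≥ e⁶ ≥ 2.718⁶ > 400`); `kh_p_nonneg`: `π/2 + 2Σ₀ ≥ 0` for `k ≥ 1`;
* **`omega_le`**: `k·√(max 0 c²(k,β)) ≤ πk/2 − (1−q)/(1+q)` for `k ≥ 1`; **`stable_detuning`**: `πk/2 − k·√(max 0 c²) ≥ 399/401` for `k ≥ 1`.
So the Duhamel integrals of the `+πk/2` forcing component against the block's `e^{±iωt}` have detuning `≥ 399/401` (ad-lit L2 / `…KHLorentzEnvelope`).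
No definitions; no statement about the crux. [cite: Drazin2002, §8.3 (8.36)–(8.38)] [problem: turb]
-/

-- `Summit.<Summit>.<Problem>`: single-conjunct summit, the duplicate namespace segment is deliberate.
set_option linter.dupNamespace false

noncomputable section

namespace Summit.AnomalousDissipation.AnomalousDissipation.Theorems.SawtoothPulseCascade.K2PhaseBudget

open Set Literature.Analysis.FluidPDE.SawtoothCascade

/-! ## §1 Two-sided bounds on the diagonal lattice sum -/

/-- `Σ₀(k,β) ≤ −(1−q)/(2k(1+q))` for `k > 0` (`q = sawQ k`): the denominator `1 − 2q cos 2πβ + q²` is at most `(1+q)²`. [cite: Drazin2002, §8.3 (8.36)–(8.38)] -/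
theorem sawSigma0_le_of_pos {k : ℝ} (hk : 0 < k) (β : ℝ) :
    sawSigma0 k β ≤ -(1 - sawQ k) / (2 * k * (1 + sawQ k)) := by
  unfold sawSigma0
  have hq0 : 0 < sawQ k := sawQ_pos k
  have hq1 : sawQ k < 1 := sawQ_lt_one hk
  set q := sawQ k
  have hc := Real.cos_le_one (2 * Real.pi * β)
  have hc' := Real.neg_one_le_cos (2 * Real.pi * β)
  have hD : 0 < 1 - 2 * q * Real.cos (2 * Real.pi * β) + q ^ 2 := by nlinarith
  have hDle : 1 - 2 * q * Real.cos (2 * Real.pi * β) + q ^ 2 ≤ (1 + q) ^ 2 := by nlinarith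
  rw [neg_div, neg_div, neg_le_neg_iff, div_le_div_iff₀ (by positivity) (by positivity)]
  have h1q2 : 1 - q ^ 2 = (1 - q) * (1 + q) := by ring
  rw [h1q2]
  have : 0 < 1 - q := by linarith
  nlinarith [mul_pos (mul_pos this hk) hD, mul_le_mul_of_nonneg_left hDle (by positivity : (0:ℝ) ≤ (1 - q) * (2 * k))]

/-- `−(1+q)/(2k(1−q)) ≤ Σ₀(k,β)` for `k > 0`: the denominator is at least `(1−q)²`. [cite: Drazin2002, §8.3 (8.36)–(8.38)] -/
theorem le_sawSigma0_of_pos {k : ℝ} (hk : 0 < k) (β : ℝ) :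
    -(1 + sawQ k) / (2 * k * (1 - sawQ k)) ≤ sawSigma0 k β := by
  unfold sawSigma0
  have hq0 : 0 < sawQ k := sawQ_pos k
  have hq1 : sawQ k < 1 := sawQ_lt_one hk
  set q := sawQ k
  have hc := Real.cos_le_one (2 * Real.pi * β)
  have hc' := Real.neg_one_le_cos (2 * Real.pi * β)
  have h1q : 0 < 1 - q := by linarith
  have hD : 0 < 1 - 2 * q * Real.cos (2 * Real.pi * β) + q ^ 2 := by nlinarith
  have hDge : (1 - q) ^ 2 ≤ 1 - 2 * q * Real.cos (2 * Real.pi * β) + q ^ 2 := by nlinarith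
  rw [neg_div, neg_div, neg_le_neg_iff, div_le_div_iff₀ (by positivity) (by positivity)]
  have h1q2 : 1 - q ^ 2 = (1 - q) * (1 + q) := by ring
  rw [h1q2]
  nlinarith [mul_pos (mul_pos h1q hk) hD, mul_le_mul_of_nonneg_left hDge (by positivity : (0:ℝ) ≤ (1 + q) * (2 * k))]

/-- `c²(k,β) ≤ (π/2 + 2Σ₀(k,β))²` (the off-diagonal term `−4|S|²` is nonpositive). [cite: Drazin2002, §8.3 (8.36)–(8.38)] -/
theorem sawC2_le_sq (k β : ℝ) : sawC2 k β ≤ (Real.pi / 2 + 2 * sawSigma0 k β) ^ 2 := by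
  unfold sawC2
  linarith [Complex.normSq_nonneg (sawS k β)]

/-! ## §2 Numerics at `k ≥ 1` -/

/-- `q = e^{−2πk} ≤ 1/400` for `k ≥ 1` (`e^{2πk} ≥ e^{6} ≥ 2.7182818283⁶ > 400`). [folklore] -/
theorem sawQ_le_of_one_le {k : ℝ} (hk : 1 ≤ k) : sawQ k ≤ 1 / 400 := by
  unfold sawQ
  have hπ : (3 : ℝ) ≤ Real.pi := by linarith [Real.pi_gt_three]
  have h6 : (6 : ℝ) ≤ 2 * Real.pi * k := by nlinarith
  have he : Real.exp (-(2 * Real.pi * k)) ≤ Real.exp (-6) := Real.exp_le_exp.2 (by linarith)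
  refine he.trans ?_
  rw [Real.exp_neg, inv_eq_one_div, div_le_div_iff₀ (Real.exp_pos _) (by norm_num), one_mul, one_mul]
  have h1 : (2.7182818283 : ℝ) < Real.exp 1 := Real.exp_one_gt_d9
  have h6' : Real.exp 6 = (Real.exp 1) ^ 6 := by rw [← Real.exp_nat_mul]; norm_num
  rw [h6']
  have h0 : (0 : ℝ) ≤ 2.7182818283 := by norm_num
  calc (400 : ℝ) ≤ (2.7182818283 : ℝ) ^ 6 := by norm_num
    _ ≤ (Real.exp 1) ^ 6 := pow_le_pow_left₀ h0 h1.le 6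

/-- `π/2 + 2Σ₀(k,β) ≥ π/2 − (1+q)/(k(1−q)) ≥ 0` for `k ≥ 1`. [cite: Drazin2002, §8.3 (8.36)–(8.38)] -/
theorem kh_p_nonneg {k : ℝ} (hk : 1 ≤ k) (β : ℝ) : 0 ≤ Real.pi / 2 + 2 * sawSigma0 k β := by
  have hk0 : 0 < k := by linarith
  have h := le_sawSigma0_of_pos hk0 β
  have hq0 : 0 < sawQ k := sawQ_pos k
  have hq := sawQ_le_of_one_le hk
  have hπ : (3.14 : ℝ) < Real.pi := Real.pi_gt_d2
  set q := sawQ k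
  -- `(1+q)/(2k(1−q)) ≤ (1 + 1/400)/(2(1 − 1/400)) < π/4`
  have h1q : 0 < 1 - q := by linarith
  have hb : (1 + q) / (2 * k * (1 - q)) ≤ 401 / 798 := by
    rw [div_le_div_iff₀ (by positivity) (by norm_num)]
    nlinarith
  have : -(1 + q) / (2 * k * (1 - q)) = -((1 + q) / (2 * k * (1 - q))) := by rw [neg_div]
  rw [this] at h
  linarith

/-! ## §3 The rotation rate of the stable block and the detuning -/

/-- **`ω(k,β) = k·√(max 0 c²(k,β)) ≤ πk/2 − (1−q)/(1+q)`** for `k ≥ 1`: `√(max 0 c²) ≤ π/2 + 2Σ₀ ≤ π/2 − (1−q)/(k(1+q))`.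
[cite: Drazin2002, §8.3 (8.36)–(8.38)] -/
theorem omega_le {k : ℝ} (hk : 1 ≤ k) (β : ℝ) :
    k * Real.sqrt (max 0 (sawC2 k β)) ≤ Real.pi * k / 2 - (1 - sawQ k) / (1 + sawQ k) := by
  have hk0 : 0 < k := by linarith
  have hp := kh_p_nonneg hk β
  have hσ := sawSigma0_le_of_pos hk0 β
  have hq0 : 0 < sawQ k := sawQ_pos k
  -- `√(max 0 c²) ≤ p`
  have h1 : Real.sqrt (max 0 (sawC2 k β)) ≤ Real.pi / 2 + 2 * sawSigma0 k β := by
    rw [Real.sqrt_le_left hp]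
    exact max_le (sq_nonneg _) (sawC2_le_sq k β)
  -- `k p ≤ πk/2 − (1−q)/(1+q)`
  have h2 : k * (Real.pi / 2 + 2 * sawSigma0 k β) ≤ Real.pi * k / 2 - (1 - sawQ k) / (1 + sawQ k) := by
    have e : k * (2 * (-(1 - sawQ k) / (2 * k * (1 + sawQ k)))) = -((1 - sawQ k) / (1 + sawQ k)) := by
      field_simp
    have := mul_le_mul_of_nonneg_left hσ (by positivity : (0:ℝ) ≤ k * 2)
    calc k * (Real.pi / 2 + 2 * sawSigma0 k β) = Real.pi * k / 2 + k * 2 * sawSigma0 k β := by ring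
      _ ≤ Real.pi * k / 2 + k * 2 * (-(1 - sawQ k) / (2 * k * (1 + sawQ k))) := by linarith
      _ = Real.pi * k / 2 - (1 - sawQ k) / (1 + sawQ k) := by rw [show k * 2 * (-(1 - sawQ k) / (2 * k * (1 + sawQ k))) =
            k * (2 * (-(1 - sawQ k) / (2 * k * (1 + sawQ k)))) by ring, e]; ring
  exact (mul_le_mul_of_nonneg_left h1 hk0.le).trans h2

/-- **Detuning of the stable block from the kink forcing:** `πk/2 − k·√(max 0 c²(k,β)) ≥ 399/401` for every `k ≥ 1` and every Bloch phase
(`(1−q)/(1+q) ≥ (1 − 1/400)/(1 + 1/400)`). [cite: Drazin2002, §8.3 (8.36)–(8.38)] -/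
theorem stable_detuning {k : ℝ} (hk : 1 ≤ k) (β : ℝ) :
    399 / 401 ≤ Real.pi * k / 2 - k * Real.sqrt (max 0 (sawC2 k β)) := by
  have h := omega_le hk β
  have hq0 : 0 < sawQ k := sawQ_pos k
  have hq := sawQ_le_of_one_le hk
  have hr : (399 : ℝ) / 401 ≤ (1 - sawQ k) / (1 + sawQ k) := by
    rw [div_le_div_iff₀ (by norm_num) (by positivity)]
    nlinarith
  linarith

end Summit.AnomalousDissipation.AnomalousDissipation.Theorems.SawtoothPulseCascade.K2PhaseBudget

end
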